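import Literature.AnabelianGeometry.SemiGraphs.OneVertexEdgelessHypotheses
import Literature.AnabelianGeometry.SemiGraphs.TemperedVerticialInjective
import Literature.AnabelianGeometry.SemiGraphs.SubdivisionLemmas
import HarnessLib

/-!
# One vertex with ANY finite number of cusps: the hypotheses of [SemiAnbd] Prop. 3.6 / Thm. 3.7 for a
# one-vertex semi-graph of anabelioids whose open edges carry an ESTRANGED family of edge groups

Mochizuki, *Semi-graphs of anabelioids*, Publ. RIMS **42** (2006) [SemiAnbd], §1 p. 11 (semi-graphs, open
edges), Def. 2.1 p. 22 (injective type), Def. 2.3 pp. 24–25 (approximators, quasi-coherence), Def. 2.4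
pp. 25–26 (totally elevated, verticially slim, totally aloof / estranged), Prop. 3.6 p. 38, Thm. 3.7 p. 40 (the
bundles, with [IUTchI] Rmk. 2.5.3 (i) (T2) Galois-countability). [cite: MochizukiSemiAnbd2006, Def 2.4 pp.25-26]

GENERIC WITNESS BRICK (abc-iut cell, layer L3, seat abc-iut-L3-t11 gen 6, step (B1) of the row
«NV-hLG@cusped»: the fibres of a cusped Example 3.10 tower are semi-graphs of anabelioids WITH OPEN EDGES
satisfying the Thm. 3.7 hypotheses; abc-iut-f-177's `cuspGraph p` is the one-edge instance, abc-iut-L3-t2's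
`OneVertex.graph` the edgeless one).  For a profinite `Π_v`, a type `ι` of cusps and `emb k : Π_{e_k} → Π_v`:
`OneVertexCusps.graph P E emb` has ONE vertex and the open edges `e_k` (abutting branch `(k, true)` with
branch map `emb k`, non-abutting branch `(k, false)`); `quotApprox` / `levelApprox` are the approximators of
finite quotients of `Π_v` (edge groups = images); the clauses are proved from: `Π_v` slim with a `LevelFamily`
(abc-iut-L3-t2), injective `emb k` with infinite `Π_{e_k}`, the ESTRANGEMENT LAW
`Π_{b_k} ∩ g Π_{b_{k'}} g⁻¹ = 1` for `k' ≠ k` or `g ∉ Π_{b_k}`, and an ELEVATION DATUM (for every `M` a finite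
quotient of `Π_v` with a subgroup of order `≥ M` meeting no conjugate of any image of a `Π_{e_k}`):
`OneVertexCusps.thm37Hypotheses`.  A witness brick certifies consistency only; not the special fibre of any
curve; no statement of the paper is touched; no instance / notation / `Prop` fact.  Nothing here bears on
[IUTchIII] Cor. 3.12.
-/

noncomputable section

open Topology CategoryTheory

namespace Literature.AnabelianGeometry.SemiGraphs

open Literature.AlgebraicGeometry.Frobenioids (IsSlimGroup)

namespace OneVertexCusps

open ProfiniteSemiGraph

universe u

/-- The semi-graph with ONE vertex and open edges indexed by `ι`: the edge `k` has the branch `(k, true)`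
abutting to the vertex and the branch `(k, false)` abutting to no vertex ([SemiAnbd] §1 p. 11: an edge `e`
with `ζ_e(b) = 𝒱` for one of its branches). [cite: MochizukiSemiAnbd2006, §1 p.11] -/
abbrev semiGraph (ι : Type u) : SemiGraph.{u} where
  Vertex := PUnit
  Edge := ι
  Branch := ι × Bool
  edgeOf b := b.1
  abuts b := cond b.2 (some PUnit.unit) none
  two_branches e := ⟨(e, true), (e, false), fun h => Bool.noConfusion (congrArg Prod.snd h), rfl, rfl,
    fun b hb => by
      obtain ⟨k, c⟩ := b
      cases hb
      cases c
      · exact Or.inr rfl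
      · exact Or.inl rfl⟩

variable {ι : Type u}

/-- A branch abutting to a vertex is an abutting branch `(k, true)`. [cite: MochizukiSemiAnbd2006, §1 p.11] -/
theorem snd_eq_true_of_abuts {b : (semiGraph ι).Branch} {v : (semiGraph ι).Vertex}
    (h : (semiGraph ι).abuts b = some v) : b.2 = true := by
  obtain ⟨k, c⟩ := b
  cases c
  · cases h
  · rfl

/-- The verticial portion of the edge `k` is `{(k, true)}`. [cite: MochizukiSemiAnbd2006, §1 p.11] -/
theorem semiGraph_verticialPortion (e : (semiGraph ι).Edge) :
    (semiGraph ι).verticialPortion e = {(e, true)} := by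
  ext b
  obtain ⟨k, c⟩ := b
  constructor
  · rintro ⟨hk, hc⟩
    cases c
    · exact (Bool.false_ne_true hc).elim
    · cases hk; exact Set.mem_singleton _
  · intro hb
    cases hb
    exact ⟨rfl, rfl⟩

/-- **Every edge is a cusp**: verticial cardinality `1`, an open edge. [cite: MochizukiSemiAnbd2006, §1 p.12] -/
theorem semiGraph_isOpenEdge (e : (semiGraph ι).Edge) :
    (semiGraph ι).vertCard e = 1 ∧ (semiGraph ι).IsOpenEdge e := by
  have h1 : (semiGraph ι).vertCard e = 1 := by
    unfold SemiGraph.vertCard; rw [semiGraph_verticialPortion]; simp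
  exact ⟨h1, by unfold SemiGraph.IsOpenEdge; rw [h1]; exact Nat.one_lt_two⟩

/-- The one-vertex semi-graph with cusps is connected: the vertex is joined to every abutting branch, which is
joined to its edge-point, which is joined to the non-abutting branch. [cite: MochizukiSemiAnbd2006, §1 p.11] -/
theorem semiGraph_isConnected : (semiGraph ι).IsConnected := by
  classical
  set G := semiGraph ι
  have htv : ∀ k : ι, G.subdivision.Reachable (Sum.inr (Sum.inr (k, true))) (Sum.inl PUnit.unit) := fun k =>
    (SemiGraph.subdivision_adj_of_nodeRel G (SemiGraph.NodeRel.branch_vertex (k, true) PUnit.unit rfl)).reachable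
  have heb : ∀ b : G.Branch, G.subdivision.Reachable (Sum.inr (Sum.inl b.1)) (Sum.inr (Sum.inr b)) :=
    fun b => (SemiGraph.subdivision_adj_of_nodeRel G (SemiGraph.NodeRel.edge_branch b)).reachable
  have hall : ∀ a : G.Node, G.subdivision.Reachable a (Sum.inl PUnit.unit) := by
    intro a
    rcases a with ⟨⟨⟩⟩ | k | b
    · exact SimpleGraph.Reachable.refl _
    · exact (heb (k, true)).trans (htv k)
    · exact ((heb b).symm.trans (heb (b.1, true))).trans (htv b.1)
  haveI : Nonempty G.Node := ⟨Sum.inl PUnit.unit⟩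
  exact ⟨⟨fun a b => (hall a).trans (hall b).symm⟩⟩

variable (P : Type u) [Group P] [TopologicalSpace P] [IsTopologicalGroup P] [CompactSpace P]
  [TotallyDisconnectedSpace P]
  (E : ι → Type u) [∀ k, Group (E k)] [∀ k, TopologicalSpace (E k)] [∀ k, IsTopologicalGroup (E k)]
  [∀ k, CompactSpace (E k)] [∀ k, TotallyDisconnectedSpace (E k)]
  (emb : ∀ k, E k →ₜ* P)

/-- **The one-vertex semi-graph of anabelioids with cusps** `e_k`, `k : ι` (local presentation): vertex group
`Π_v`, edge groups `Π_{e_k}`, the abutting branch of `e_k` mapping `Π_{e_k} → Π_v` by `emb k`.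
[cite: MochizukiSemiAnbd2006, Def 2.1 p.22] -/
abbrev graph : ProfiniteSemiGraph.{u} where
  graph := semiGraph ι
  Gv _ := P
  Ge k := E k
  brHom b _ _ := emb b.1

variable {P E emb}

/-- The branch subgroups are the images of the `emb k`. [cite: MochizukiSemiAnbd2006, §2 p.23] -/
theorem graph_branchSubgroup (b : (semiGraph ι).Branch) (v : (semiGraph ι).Vertex)
    (h : (semiGraph ι).abuts b = some v) :
    (graph P E emb).branchSubgroup b v h = (emb b.1).toMonoidHom.range := rfl

/-- A subgroup meeting an INFINITE subgroup `K` trivially has relative index `0` (infinite index) in it.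
[cite: MochizukiSemiAnbd2006, Def 2.4(iv) p.26] -/
theorem relIndex_eq_zero_of_inf_eq_bot {G : Type*} [Group G] (K H : Subgroup G) (hK : Infinite K)
    (h : K ⊓ H = ⊥) : H.relIndex K = 0 := by
  haveI := hK
  rw [Subgroup.relIndex, show H.subgroupOf K = ⊥ from ?_, Subgroup.index_bot]
  · exact Nat.card_eq_zero_of_infinite
  · rw [eq_bot_iff]
    intro z hz
    rw [Subgroup.mem_bot]
    have : (z : G) ∈ K ⊓ H := ⟨z.2, hz⟩
    rw [h, Subgroup.mem_bot] at this
    exact Subtype.ext this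

omit [IsTopologicalGroup P] [CompactSpace P] [TotallyDisconnectedSpace P] [∀ k, IsTopologicalGroup (E k)]
  [∀ k, CompactSpace (E k)] [∀ k, TotallyDisconnectedSpace (E k)] in
/-- The image of an infinite edge group under an injective branch map is infinite.
[cite: MochizukiSemiAnbd2006, Def 2.4(iv) p.26] -/
theorem infinite_range (k : ι) (hinj : Function.Injective (emb k)) [Infinite (E k)] :
    Infinite (emb k).toMonoidHom.range :=
  Infinite.of_injective (fun y : E k => ⟨emb k y, y, rfl⟩) fun _ _ h => hinj (congrArg Subtype.val h)

omit [IsTopologicalGroup P] [CompactSpace P] [TotallyDisconnectedSpace P] [∀ k, IsTopologicalGroup (E k)]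
  [∀ k, CompactSpace (E k)] [∀ k, TotallyDisconnectedSpace (E k)] in
/-- The core intersection computation transported to branches: for abutting branches `b = (k, true)`,
`b' = (k', true)` and `g ∈ Π_v` with `b' ≠ b` or `g ∉ Π_b`, the ESTRANGEMENT LAW gives `Π_b ∩ g Π_{b'} g⁻¹ = 1`.
[cite: MochizukiSemiAnbd2006, Def 2.4(iv) p.26] -/
theorem branch_inf_conj_eq_bot
    (hest : ∀ (k k' : ι) (g : P), (k' ≠ k ∨ g ∉ (emb k).toMonoidHom.range) →
      (emb k).toMonoidHom.range ⊓ ((emb k').toMonoidHom.range.map (MulAut.conj g).toMonoidHom) = ⊥)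
    {b b' : (semiGraph ι).Branch} {v : (semiGraph ι).Vertex}
    (h : (semiGraph ι).abuts b = some v) (h' : (semiGraph ι).abuts b' = some v) (g : P)
    (hg : b' ≠ b ∨ g ∉ (emb b.1).toMonoidHom.range) :
    (emb b.1).toMonoidHom.range ⊓ ((emb b'.1).toMonoidHom.range.map (MulAut.conj g).toMonoidHom) = ⊥ := by
  refine hest b.1 b'.1 g (hg.imp (fun hne heq => hne ?_) id)
  have h2 := snd_eq_true_of_abuts h
  have h2' := snd_eq_true_of_abuts h'
  exact Prod.ext heq (h2'.trans h2.symm)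

/-- **Totally aloof** from the estrangement law (infinite edge groups, injective branch maps).
[cite: MochizukiSemiAnbd2006, Def 2.4(iv) p.26] -/
theorem isTotallyAloof (hinj : ∀ k, Function.Injective (emb k)) (hinf : ∀ k, Infinite (E k))
    (hest : ∀ (k k' : ι) (g : P), (k' ≠ k ∨ g ∉ (emb k).toMonoidHom.range) →
      (emb k).toMonoidHom.range ⊓ ((emb k').toMonoidHom.range.map (MulAut.conj g).toMonoidHom) = ⊥) :
    (graph P E emb).IsTotallyAloof := by
  intro e b _ v h b' h' g hg
  rw [graph_branchSubgroup] at hg ⊢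
  rw [graph_branchSubgroup]
  haveI := hinf b.1
  exact relIndex_eq_zero_of_inf_eq_bot _ _ (infinite_range (emb := emb) b.1 (hinj b.1))
    (branch_inf_conj_eq_bot hest h h' g hg)

/-- **Totally estranged** from the estrangement law. [cite: MochizukiSemiAnbd2006, Def 2.4(iv) p.26] -/
theorem isTotallyEstranged (hinj : ∀ k, Function.Injective (emb k)) (hinf : ∀ k, Infinite (E k))
    (hest : ∀ (k k' : ι) (g : P), (k' ≠ k ∨ g ∉ (emb k).toMonoidHom.range) →
      (emb k).toMonoidHom.range ⊓ ((emb k').toMonoidHom.range.map (MulAut.conj g).toMonoidHom) = ⊥) :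
    (graph P E emb).IsTotallyEstranged := by
  intro e
  refine ⟨isTotallyAloof hinj hinf hest e, ?_⟩
  intro b _ v h b' h' g hg
  rw [graph_branchSubgroup] at hg ⊢
  rw [graph_branchSubgroup]
  exact branch_inf_conj_eq_bot hest h h' g hg

section Approx

variable {F : Type u} [Group F] [Finite F] (π : P →* F) (hπ : IsOpen (π.ker : Set P))

variable (emb) in
/-- **The approximator attached to a finite quotient `π : Π_v → F` with open kernel** (Def. 2.3 (i)(ii)):
vertex group `F`, edge group of `e_k` the image `π(emb k(Π_{e_k})) ≤ F`, branch maps the inclusions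
(injective; compatible with `emb k` on the nose, `g = 1`), of bounded order `|F|`.
[cite: MochizukiSemiAnbd2006, Def 2.3(i) p.24] -/
def quotApprox : (graph P E emb).Approximator where
  FV _ := F
  FE k := (π.comp (emb k).toMonoidHom).range
  πV _ := π
  πE k := (π.comp (emb k).toMonoidHom).rangeRestrict
  isOpen_ker_πV _ := hπ
  isOpen_ker_πE := fun (k : ι) => by
    have : (((π.comp (emb k).toMonoidHom).rangeRestrict).ker : Set (E k)) = emb k ⁻¹' (π.ker : Set P) := by
      ext x
      simp only [SetLike.mem_coe, MonoidHom.mem_ker, Set.mem_preimage]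
      rw [Subtype.ext_iff]
      rfl
    rw [this]
    exact hπ.preimage (emb k).continuous
  brF b _ _ := (π.comp (emb b.1).toMonoidHom).range.subtype
  brF_injective _ _ _ := Subgroup.subtype_injective _
  comm b v h := ⟨1, fun x => by rw [one_mul, inv_one, mul_one]; rfl⟩
  bounded := ⟨Nat.card F, Nat.card_pos, fun _ => dvd_rfl⟩

/-- The approximator of a SURJECTIVE finite quotient is `π₁`-epimorphic. [cite: MochizukiSemiAnbd2006, Def 2.3(ii) p.25] -/
theorem quotApprox_isPiOneEpimorphic (hsurj : Function.Surjective π) :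
    (quotApprox emb π hπ).IsPiOneEpimorphic :=
  ⟨fun _ => hsurj, fun k => (π.comp (emb k).toMonoidHom).rangeRestrict_surjective⟩

/-- The range of a branch map of `quotApprox π` is `π(emb k(Π_{e_k}))`. [cite: MochizukiSemiAnbd2006, Def 2.3(i) p.24] -/
theorem quotApprox_range_brF (b : (semiGraph ι).Branch) (v : (semiGraph ι).Vertex)
    (h : (semiGraph ι).abuts b = some v) :
    ((quotApprox emb π hπ).brF b v h).range = (π.comp (emb b.1).toMonoidHom).range :=
  Subgroup.range_subtype _

end Approx

/-- The approximator of the level-`n` quotient `Π_v ↠ Π_v/N_n` of a level family.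
[cite: MochizukiSemiAnbd2006, Def 2.3(i) p.24] -/
def levelApprox (L : LevelFamily P) (n : ℕ) : (graph P E emb).Approximator :=
  haveI := L.normal n
  haveI := L.finiteQuotient n
  quotApprox emb (QuotientGroup.mk' (L.N n)) (by rw [QuotientGroup.ker_mk' (L.N n)]; exact L.isOpen n)

/-- The vertex kernel of the level-`n` approximator is `N_n`. [cite: MochizukiSemiAnbd2006, Def 2.3(i) p.24] -/
theorem levelApprox_πV_eq_one_iff (L : LevelFamily P) (n : ℕ) (v : (semiGraph ι).Vertex) (g : P) :
    (levelApprox (emb := emb) L n).πV v g = 1 ↔ g ∈ L.N n := by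
  haveI := L.normal n
  exact QuotientGroup.eq_one_iff g

/-- The edge kernels of the level-`n` approximator are the pull-backs `emb k⁻¹(N_n)`.
[cite: MochizukiSemiAnbd2006, Def 2.3(i) p.24] -/
theorem levelApprox_πE_eq_one_iff (L : LevelFamily P) (n : ℕ) (k : ι) (g : E k) :
    (levelApprox (emb := emb) L n).πE k g = 1 ↔ emb k g ∈ L.N n := by
  haveI := L.normal n
  constructor
  · intro h
    have h2 := congrArg Subtype.val h
    exact (QuotientGroup.eq_one_iff (emb k g)).mp h2
  · intro h
    exact Subtype.ext ((QuotientGroup.eq_one_iff (emb k g)).mpr h)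

/-- The pointwise stabiliser of a FINITE object of `B^temp(G)` is an open neighbourhood of `1`.
[cite: MochizukiSemiAnbd2006, Rmk 3.1.1 p.33] -/
theorem isOpen_fixingSet {G : Type u} [Group G] [TopologicalSpace G] (X : BTemp G) [Finite X.obj.V] :
    IsOpen {g : G | ∀ s : X.obj.V, X.obj.ρ g s = s} ∧ (1 : G) ∈ {g : G | ∀ s : X.obj.V, X.obj.ρ g s = s} := by
  refine ⟨?_, fun s => by rw [map_one]; rfl⟩
  have e : {g : G | ∀ s : X.obj.V, X.obj.ρ g s = s} = ⋂ s : X.obj.V, {g : G | X.obj.ρ g s = s} := by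
    ext g; simp
  rw [e]
  exact isOpen_iInter_of_finite fun s => X.property.2 s

omit [IsTopologicalGroup P] [CompactSpace P] [TotallyDisconnectedSpace P] [∀ k, IsTopologicalGroup (E k)]
  [∀ k, TotallyDisconnectedSpace (E k)] in
/-- Along an injective branch map (a closed embedding `Π_{e_k} ↪ Π_v`), the pointwise stabiliser of a finite
`Π_{e_k}`-set is cut out by an open neighbourhood of `1` in `Π_v`. [cite: MochizukiSemiAnbd2006, Def 2.3(iii) p.25] -/
theorem exists_open_preimage_subset_fixing [T2Space P] (k : ι) (hinj : Function.Injective (emb k))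
    (X : BTemp (E k)) [Finite X.obj.V] :
    ∃ W : Set P, IsOpen W ∧ (1 : P) ∈ W ∧ ∀ g : E k, emb k g ∈ W → ∀ s : X.obj.V, X.obj.ρ g s = s := by
  obtain ⟨hK, h1⟩ := isOpen_fixingSet X
  have hemb : Topology.IsClosedEmbedding (emb k) := (emb k).continuous.isClosedEmbedding hinj
  obtain ⟨W, hW, hWK⟩ := hemb.isInducing.isOpen_iff.mp hK
  refine ⟨W, hW, ?_, fun g hg => ?_⟩
  · have : (1 : E k) ∈ emb k ⁻¹' W := by rw [hWK]; exact h1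
    simpa using this
  · have : g ∈ emb k ⁻¹' W := hg
    rw [hWK] at this
    exact this

omit [IsTopologicalGroup P] [CompactSpace P] [TotallyDisconnectedSpace P] [∀ k, IsTopologicalGroup (E k)]
  [∀ k, TotallyDisconnectedSpace (E k)] in
/-- Given a `LevelFamily` on `Π_v` (finitely many cusps, injective branch maps), every finite family of finite
vertex- and edge-objects is fixed by some level `N_n` and its pull-backs `emb k⁻¹(N_n)`.
[cite: MochizukiSemiAnbd2006, Def 2.3(iii) p.25] -/
theorem exists_level_fixing_all [Finite ι] [T2Space P] (L : LevelFamily P)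
    (hinj : ∀ k, Function.Injective (emb k))
    (HV : BTemp P) [Finite HV.obj.V] (HE : ∀ k : ι, BTemp (E k)) [∀ k, Finite (HE k).obj.V] :
    ∃ n : ℕ, (∀ g ∈ L.N n, ∀ s : HV.obj.V, HV.obj.ρ g s = s) ∧
      ∀ (k : ι) (g : E k), emb k g ∈ L.N n → ∀ s : (HE k).obj.V, (HE k).obj.ρ g s = s := by
  classical
  obtain ⟨hUV, h1V⟩ := isOpen_fixingSet HV
  choose W hW h1W hWfix using fun k => exists_open_preimage_subset_fixing (emb := emb) k (hinj k) (HE k)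
  have hopen : IsOpen ({g : P | ∀ s : HV.obj.V, HV.obj.ρ g s = s} ∩ ⋂ k, W k) :=
    hUV.inter (isOpen_iInter_of_finite hW)
  have hone : (1 : P) ∈ {g : P | ∀ s : HV.obj.V, HV.obj.ρ g s = s} ∩ ⋂ k, W k :=
    ⟨h1V, Set.mem_iInter.mpr h1W⟩
  obtain ⟨n, hn⟩ := L.basis _ hopen hone
  refine ⟨n, fun g hg => (hn hg).1, fun k g hg => hWfix k g ?_⟩
  exact Set.mem_iInter.mp (hn hg).2 k

/-- **Quasi-coherent** (Def. 2.3 (iii)) from a level family on `Π_v`: the approximator of the quotient by a deep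
enough level splits any given finite coverings of the constituents. [cite: MochizukiSemiAnbd2006, Def 2.3(iii) p.25] -/
theorem isQuasiCoherent [Finite ι] [T2Space P] (L : LevelFamily P) (hinj : ∀ k, Function.Injective (emb k)) :
    (graph P E emb).IsQuasiCoherent := by
  intro M HV HE hV hE
  haveI : Finite (HV PUnit.unit).obj.V := (hV PUnit.unit).2
  haveI : ∀ k : ι, Finite (HE k).obj.V := fun k => (hE k).2
  obtain ⟨n, hnV, hnE⟩ := exists_level_fixing_all (emb := emb) L hinj (HV PUnit.unit) HE
  refine ⟨levelApprox L n, ?_, ?_⟩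
  · rintro ⟨⟩ g hg x
    exact hnV g ((levelApprox_πV_eq_one_iff L n PUnit.unit g).mp hg) x
  · intro k g hg x
    exact hnE k g ((levelApprox_πE_eq_one_iff (emb := emb) L n k g).mp hg) x

/-- **Totally elevated** (Def. 2.4 (i)) from an ELEVATION DATUM: for every `M` a finite quotient `π : Π_v ↠ F`
with open kernel and a subgroup `S ≤ F` of order `≥ M` meeting no conjugate of any `π(emb k(Π_{e_k}))`.
[cite: MochizukiSemiAnbd2006, Def 2.4(i) p.25] -/
theorem isTotallyElevated
    (helev : ∀ M : ℕ, ∃ (F : Type u) (_ : Group F) (_ : Finite F) (π : P →* F),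
      IsOpen (π.ker : Set P) ∧ Function.Surjective π ∧ ∃ S : Subgroup F, M ≤ Nat.card S ∧
        ∀ (k : ι) (g : F), S ⊓ ((π.comp (emb k).toMonoidHom).range.map (MulAut.conj g).toMonoidHom) = ⊥) :
    (graph P E emb).IsTotallyElevated := by
  intro v M
  obtain ⟨F, _, _, π, hπ, hsurj, S, hS, hmeet⟩ := helev M
  refine ⟨quotApprox emb π hπ, quotApprox_isPiOneEpimorphic π hπ hsurj, S, hS, ?_⟩
  intro b h g
  rw [quotApprox_range_brF]
  exact hmeet b.1 g

/-- The trivialising covering of the level-`n` approximator: a finite object of `B^cov` with nonempty fibres.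
[cite: MochizukiSemiAnbd2006, Prop 2.5 p.27] -/
def levelCov (L : LevelFamily P) (n : ℕ) : CovObj (graph P E emb) :=
  haveI := L.finiteQuotient n
  (levelApprox L n).trivCov (M := Nat.card (P ⧸ L.N n)) Nat.card_pos fun _ => dvd_rfl

/-- **Galois-countable** ([IUTchI] Rmk. 2.5.3 (i) (T2)) from a level family on `Π_v`: the trivialising coverings
of the level approximators split every finite covering. [cite: Mochizuki2012, IUTchI Rmk 2.5.3 (i) (T2), p. 52] -/
theorem isGaloisCountable [Finite ι] [T2Space P] (L : LevelFamily P) (hinj : ∀ k, Function.Injective (emb k)) :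
    (graph P E emb).IsGaloisCountable := by
  refine ⟨⟨inferInstanceAs (Countable PUnit), inferInstanceAs (Countable ι)⟩, levelCov L,
    fun n => ⟨?_, ?_⟩, ?_⟩
  · haveI := L.finiteQuotient n
    exact (levelApprox L n).trivCov_isFinite _ _
  · haveI := L.finiteQuotient n
    exact (levelApprox L n).trivCov_hasNonemptyFibres _ _
  · intro H hH
    haveI : Finite (H.SV PUnit.unit).obj.V := hH.finite_V PUnit.unit
    haveI : ∀ k : ι, Finite (H.SE k).obj.V := fun k => hH.finite_E k
    obtain ⟨n, hnV, hnE⟩ := exists_level_fixing_all (emb := emb) L hinj (H.SV PUnit.unit) H.SE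
    haveI := L.finiteQuotient n
    refine ⟨n, ?_, ?_⟩
    · rintro ⟨⟩ x g hgx s
      have h' : ((levelApprox (emb := emb) L n).objV (Nat.card (P ⧸ L.N n)) PUnit.unit).obj.ρ g x = x := hgx
      rw [Approximator.objV_ρ] at h'
      exact hnV g ((levelApprox_πV_eq_one_iff L n _ g).mp (mul_eq_right.1 (Prod.ext_iff.1 h').1)) s
    · intro k x g hgx s
      have h' : ((levelApprox (emb := emb) L n).objE (Nat.card (P ⧸ L.N n)) k).obj.ρ g x = x := hgx
      rw [Approximator.objE_ρ] at h'
      exact hnE k g ((levelApprox_πE_eq_one_iff L n k g).mp (mul_eq_right.1 (Prod.ext_iff.1 h').1)) s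

/-- **A one-vertex semi-graph of anabelioids with ANY finite number of cusps satisfies the hypotheses of
[SemiAnbd] Prop. 3.6 and Thm. 3.7** provided: `Π_v` slim (Hausdorff) with a level family, injective branch maps
with infinite edge groups subject to the estrangement law, and an elevation datum.
[cite: MochizukiSemiAnbd2006, Thm 3.7 p.40] -/
theorem thm37Hypotheses [Finite ι] [T2Space P] (L : LevelFamily P) (hslim : IsSlimGroup P)
    (hinj : ∀ k, Function.Injective (emb k)) (hinf : ∀ k, Infinite (E k))
    (hest : ∀ (k k' : ι) (g : P), (k' ≠ k ∨ g ∉ (emb k).toMonoidHom.range) →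
      (emb k).toMonoidHom.range ⊓ ((emb k').toMonoidHom.range.map (MulAut.conj g).toMonoidHom) = ⊥)
    (helev : ∀ M : ℕ, ∃ (F : Type u) (_ : Group F) (_ : Finite F) (π : P →* F),
      IsOpen (π.ker : Set P) ∧ Function.Surjective π ∧ ∃ S : Subgroup F, M ≤ Nat.card S ∧
        ∀ (k : ι) (g : F), S ⊓ ((π.comp (emb k).toMonoidHom).range.map (MulAut.conj g).toMonoidHom) = ⊥) :
    (graph P E emb).Thm37Hypotheses where
  toProp36Hypotheses :=
    { isConnected := semiGraph_isConnected
      isCountable := ⟨inferInstanceAs (Countable PUnit), inferInstanceAs (Countable ι)⟩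
      isGaloisCountable := isGaloisCountable L hinj
      hasVertex := ⟨PUnit.unit⟩
      isOfInjectiveType := fun b _ _ => hinj b.1
      isQuasiCoherent := isQuasiCoherent L hinj
      isTotallyElevated := isTotallyElevated helev
      isTotallyAloof := isTotallyAloof hinj hinf hest
      isVerticiallySlim := fun _ => hslim }
  isTotallyEstranged := isTotallyEstranged hinj hinf hest

end OneVertexCusps

end Literature.AnabelianGeometry.SemiGraphs

end
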